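import Mathlib

/-!
# `GappedShellCensus.FiveFoldRationingR`, stub F1: a bond has at most five common partners

In an all-gapped-twelve configuration `Y ⊆ ℝ³` at scale `a > 0` (every site has exactly twelve other
sites within `1.02 a`, no two sites are closer than `0.98 a`, and no pair of sites is at distance in
`(1.02 a, 1.26 a)`), a bond `(y, v)` (`v ≠ y`, `dist y v ≤ 1.02 a`) has at most FIVE common bond
partners.  The proof is bookkeeping on top of two geometric inputs taken as hypotheses:

* the LENS geometry of a bond: the component `q` of `u - y` orthogonal to `v - y`, for a common
  partner `u`, is orthogonal to the bond, has `‖q‖² ≥ 0.69 a²`, and two common partners at mutual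
  distance `≥ 0.98 a` have components at angle `≥ arccos (41/100)`;
* the planar angular pigeonhole: six nonzero vectors orthogonal to a fixed `b ≠ 0` cannot be
  pairwise at angle `≥ arccos (41/100)`.

Six common partners would give six such components about the bond `b = v - y`, a contradiction.
-/

namespace Summit.AtomisticToContinuum.Crystallization.Theorems

/-- A vector whose norm square is at least `0.69 a²`, `a > 0`, is nonzero. -/
theorem ffrF1_ne_zero_of_sq_le {a : ℝ} (ha : 0 < a) {q : EuclideanSpace ℝ (Fin 3)}
    (h : 69 / 100 * a ^ 2 ≤ ‖q‖ ^ 2) : q ≠ 0 := by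
  intro hq
  rw [hq, norm_zero] at h
  nlinarith [sq_pos_of_pos ha]

/-- A set with more than five elements (in the sense of `Set.ncard`) contains six distinct points,
packaged as an injective map from `Fin 6`. -/
theorem ffrF1_six_points {E : Type*} {C : Set E} (h : ¬ C.ncard ≤ 5) :
    ∃ u : Fin 6 → E, Function.Injective u ∧ ∀ i, u i ∈ C := by
  obtain ⟨D, hDC, hD6⟩ := Set.exists_subset_card_eq (show 6 ≤ C.ncard by omega)
  have hDfin : D.Finite := Set.finite_of_ncard_pos (by omega)
  haveI : Finite D := hDfin.to_subtype
  have hcard : Nat.card D = 6 := by rw [Nat.card_coe_set_eq]; exact hD6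
  let e : D ≃ Fin 6 := Finite.equivFinOfCardEq hcard
  exact ⟨fun i => ((e.symm i : D) : E), Subtype.val_injective.comp e.symm.injective,
    fun i => hDC (e.symm i).2⟩

/-- **F1: at most five common partners.** In an all-gapped-twelve configuration every bond `(y, v)`
has at most five common bond partners.  Six of them, `u₀, …, u₅`, would be pairwise at distance
`≥ 0.98 a` (hard core) and in the band `[0.98 a, 1.02 a]` of both `y` and `v`, so by the lens
hypothesis their components orthogonal to `v - y` are six nonzero vectors orthogonal to `v - y ≠ 0`
with pairwise cosines `≤ 41/100` — excluded by the planar pigeonhole hypothesis. -/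
theorem stub_ffrCommonLeFive :
    (∀ (a : ℝ), 0 < a → ∀ (y w : EuclideanSpace ℝ (Fin 3)),
      a * (1 - 1 / 50) ≤ dist y w → dist y w ≤ a * (1 + 1 / 50) →
      (∀ u : EuclideanSpace ℝ (Fin 3),
          a * (1 - 1 / 50) ≤ dist y u → dist y u ≤ a * (1 + 1 / 50) →
          a * (1 - 1 / 50) ≤ dist w u → dist w u ≤ a * (1 + 1 / 50) →
          inner ℝ ((u - y) - (inner ℝ (u - y) (w - y) / inner ℝ (w - y) (w - y)) • (w - y)) (w - y) = 0 ∧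
          |inner ℝ (u - y) (w - y) / inner ℝ (w - y) (w - y) - 1 / 2| ≤ 21 / 500 ∧
          69 / 100 * a ^ 2 ≤
            ‖(u - y) - (inner ℝ (u - y) (w - y) / inner ℝ (w - y) (w - y)) • (w - y)‖ ^ 2) ∧
      (∀ u₁ u₂ : EuclideanSpace ℝ (Fin 3),
          a * (1 - 1 / 50) ≤ dist y u₁ → dist y u₁ ≤ a * (1 + 1 / 50) →
          a * (1 - 1 / 50) ≤ dist w u₁ → dist w u₁ ≤ a * (1 + 1 / 50) →
          a * (1 - 1 / 50) ≤ dist y u₂ → dist y u₂ ≤ a * (1 + 1 / 50) →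
          a * (1 - 1 / 50) ≤ dist w u₂ → dist w u₂ ≤ a * (1 + 1 / 50) →
          a * (1 - 1 / 50) ≤ dist u₁ u₂ →
          inner ℝ ((u₁ - y) - (inner ℝ (u₁ - y) (w - y) / inner ℝ (w - y) (w - y)) • (w - y))
              ((u₂ - y) - (inner ℝ (u₂ - y) (w - y) / inner ℝ (w - y) (w - y)) • (w - y)) ≤
            41 / 100 * (‖(u₁ - y) - (inner ℝ (u₁ - y) (w - y) / inner ℝ (w - y) (w - y)) • (w - y)‖ *
              ‖(u₂ - y) - (inner ℝ (u₂ - y) (w - y) / inner ℝ (w - y) (w - y)) • (w - y)‖))) →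
    (∀ (b : EuclideanSpace ℝ (Fin 3)), b ≠ 0 → ∀ q : Fin 6 → EuclideanSpace ℝ (Fin 3),
        (∀ i, q i ≠ 0) → (∀ i, inner ℝ (q i) b = 0) →
        (∀ i j, i ≠ j → inner ℝ (q i) (q j) ≤ 41 / 100 * (‖q i‖ * ‖q j‖)) → False) →
    ∀ (Y : Set (EuclideanSpace ℝ (Fin 3))) (a : ℝ), 0 < a →
      (∀ y ∈ Y, ({w ∈ Y | w ≠ y ∧ dist y w ≤ a * (1 + 1 / 50)}.ncard = 12 ∧
        ∀ w ∈ Y, w ≠ y → a * (1 - 1 / 50) ≤ dist y w ∧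
          (dist y w ≤ a * (1 + 1 / 50) ∨ a * (63 / 50) ≤ dist y w))) →
      ∀ y ∈ Y, ∀ v ∈ Y, v ≠ y → dist y v ≤ a * (1 + 1 / 50) →
        {w ∈ Y | w ≠ y ∧ w ≠ v ∧ dist y w ≤ a * (1 + 1 / 50) ∧ dist v w ≤ a * (1 + 1 / 50)}.ncard ≤ 5 := by
  intro hlens hcirc Y a ha hgap y hy v hv hvy hyv
  by_contra hgt
  -- six distinct common partners `u 0, …, u 5`
  obtain ⟨u, huinj, huC⟩ := ffrF1_six_points hgt
  have hmem : ∀ i, u i ∈ Y ∧ u i ≠ y ∧ u i ≠ v ∧ dist y (u i) ≤ a * (1 + 1 / 50) ∧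
      dist v (u i) ≤ a * (1 + 1 / 50) := fun i => huC i
  have huY : ∀ i, u i ∈ Y := fun i => (hmem i).1
  have hyu : ∀ i, dist y (u i) ≤ a * (1 + 1 / 50) := fun i => (hmem i).2.2.2.1
  have hvu : ∀ i, dist v (u i) ≤ a * (1 + 1 / 50) := fun i => (hmem i).2.2.2.2
  -- hard-core lower bounds from the gapped hypothesis at `y`, `v` and `u i`
  have hyu' : ∀ i, a * (1 - 1 / 50) ≤ dist y (u i) := fun i =>
    ((hgap y hy).2 (u i) (huY i) (hmem i).2.1).1
  have hvu' : ∀ i, a * (1 - 1 / 50) ≤ dist v (u i) := fun i =>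
    ((hgap v hv).2 (u i) (huY i) (hmem i).2.2.1).1
  have huu : ∀ i j, i ≠ j → a * (1 - 1 / 50) ≤ dist (u i) (u j) := fun i j hij =>
    ((hgap (u i) (huY i)).2 (u j) (huY j) (fun h => hij (huinj h).symm)).1
  have hyv' : a * (1 - 1 / 50) ≤ dist y v := ((hgap y hy).2 v hv hvy).1
  -- lens geometry of the bond `(y, v)`
  obtain ⟨hL1, hL2⟩ := hlens a ha y v hyv' hyv
  -- the six components orthogonal to the bond contradict the planar pigeonhole
  refine hcirc (v - y) (sub_ne_zero.2 hvy)
    (fun i => (u i - y) - (inner ℝ (u i - y) (v - y) / inner ℝ (v - y) (v - y)) • (v - y)) ?_ ?_ ?_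
  · intro i
    exact ffrF1_ne_zero_of_sq_le ha (hL1 (u i) (hyu' i) (hyu i) (hvu' i) (hvu i)).2.2
  · intro i
    exact (hL1 (u i) (hyu' i) (hyu i) (hvu' i) (hvu i)).1
  · intro i j hij
    exact hL2 (u i) (u j) (hyu' i) (hyu i) (hvu' i) (hvu i) (hyu' j) (hyu j) (hvu' j) (hvu j)
      (huu i j hij)

end Summit.AtomisticToContinuum.Crystallization.Theorems
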